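import Literature.NumberTheory.IwasawaTheory.ClassicalMuVanishesBoundedRankProofs
import Literature.NumberTheory.IwasawaTheory.Fukuda1994Thm1RankProofs
import Literature.NumberTheory.IwasawaTheory.ClassicalMuVanishesSubextension
import Literature.NumberTheory.IwasawaTheory.ClassicalMuVanishesNormRelationTowerCyclotomic
import HarnessLib

/-!
# «`μ = 0` iff the `p`-ranks are bounded» (Washington Prop. 13.23) — BOTH directions at finite level, and the
# GROWTH-THEOREM-FREE forms of the cell's μ-descent lemmas

Topic `NumberTheory/IwasawaTheory` (namespace = path). THEOREM-ONLY file (no definition, no named fact, no `sorry`), written by the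
prover seat `bsd-potss-k8t-c4` g22 (cell `bsd-potss`; μ-road of stmt-BirchSwinnertonDyer-19982; closes nothing).

* §1 `classicalMuVanishes_of_forall_classGroupPRank_le` — **BOUNDED `p`-RANKS ⟹ `μ = 0` (growth form)**: with `r_m ≤ B ≤ p^{k₀}` for all
  `m`, g20's `Fukuda1994Thm1RankProofs.layer_data` (ii) gives the concavity `e_m + e_{m+2} ≤ 2e_{m+1}` for `m ≥ n₀ + k₀ + 1`, and a sequence
  of naturals with non-increasing differences is eventually linear.  With `exists_forall_classGroupPRank_le_of_classicalMuVanishes` (g22):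
  **`classicalMuVanishes_iff_exists_forall_classGroupPRank_le`** — Washington's Prop. 13.23 «`μ = 0` ⟺ `rank A_n` bounded» as a tree
  theorem, proved in finite Galois groups, WITHOUT the structure theory of `Λ`-modules and WITHOUT Iwasawa's growth theorem
  (`iwasawa1959_classNumberPExp_growth` stays a named fact; only its `μ = 0` shadow is needed by the cell and is now unconditional).
* §2 `classicalMuVanishes_of_classNumberPExp_le_linear'` — a LINEAR UPPER BOUND `e_n ≤ a n + b` forces the growth form (hI-free twin of
  `ClassicalMuVanishesDescent.classicalMuVanishes_of_classNumberPExp_le_linear`); `classicalMuVanishes_of_le_sum'` — the μ-descent,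
  inequality form, hI-free (twin of `classicalMuVanishes_of_le_sum`).
* §3 hI-free twins of the two generic tower descents: `classicalMuVanishes_restrict_of_tower'` / `classicalMuVanishes_of_isCyclotomic_of_tower'`
  (`p`-prime index, `ClassicalMuVanishesSubextension`) and `classicalMuVanishes_restrict_of_normRelation'` /
  `classicalMuVanishes_of_isCyclotomic_of_normRelation''` (norm relations, `ClassicalMuVanishesNormRelationTower`).

Every consumer of the unprimed theorems can drop its `hI` binder by switching to the primed twin (same remaining arguments).

References: [Washington1997] §13.3 Prop. 13.23 (and its proof), Lemmas 13.14–13.18, Prop. 13.22; [Lang1990] Ch. 5 §1 Thm. 1.2 (iii);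
[Fukuda1994] Thm. 1 (2), p. 264; [BiasseEtAl2022] Prop. 3.7; [NeukirchANT1999] Ch. III §1 Prop. (1.6) (ii).
-/

noncomputable section

open scoped NumberField
open NumberField Field Finset IntermediateField

namespace Literature.NumberTheory.IwasawaTheory

open Literature.NumberTheory.EllipticCurves Literature.NumberTheory.EllipticCurves.ZpExtension
  Literature.NumberTheory.GaloisRepresentations

variable {K : Type} [Field K] [NumberField K] {p : ℕ} [hp : Fact p.Prime]

/-! ## §1 Bounded `p`-ranks ⟹ `μ = 0`; the equivalence -/

/-- A sequence of naturals whose consecutive differences do not increase from some index on (`f m + f (m+2) ≤ 2 f (m+1)`) is eventually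
LINEAR (re-proved: the version of `Fukuda1994Thm1RankProofs` is private). [folklore] -/
private theorem eventually_linear_of_concave' {f : ℕ → ℕ} {m₁ : ℕ} (h : ∀ m, m₁ ≤ m → f m + f (m + 2) ≤ 2 * f (m + 1)) :
    ∃ (l : ℕ) (ν : ℤ) (n₁ : ℕ), ∀ m, n₁ ≤ m → (f m : ℤ) = l * m + ν := by
  have hdiff : ∀ m, m₁ ≤ m → (f (m + 2) : ℤ) - f (m + 1) ≤ (f (m + 1) : ℤ) - f m := by
    intro m hm
    have := h m hm
    omega
  have hmono : ∀ m m', m₁ ≤ m → m ≤ m' → (f (m' + 1) : ℤ) - f m' ≤ (f (m + 1) : ℤ) - f m := by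
    intro m m' hm hmm'
    induction m', hmm' using Nat.le_induction with
    | base => exact le_rfl
    | succ m' hmm' ih => exact (hdiff m' (hm.trans hmm')).trans ih
  have hnonneg : ∀ m, m₁ ≤ m → (0 : ℤ) ≤ (f (m + 1) : ℤ) - f m := by
    intro m hm
    by_contra hneg
    push Not at hneg
    have hdec : ∀ s : ℕ, (f (m + s) : ℤ) ≤ f m - s := by
      intro s
      induction s with
      | zero => simp
      | succ s ih =>
        have h1 := hmono m (m + s) hm (Nat.le_add_right m s)
        rw [show m + (s + 1) = m + s + 1 by ring]
        push_cast
        linarith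
    have h1 := hdec (f m + 1)
    have h2 : (0 : ℤ) ≤ f (m + (f m + 1)) := Int.natCast_nonneg _
    push_cast at h1
    linarith
  classical
  let S : Set ℕ := {v | ∃ m, m₁ ≤ m ∧ ((f (m + 1) : ℤ) - f m) = v}
  have hSne : S.Nonempty := ⟨((f (m₁ + 1) : ℤ) - f m₁).toNat, m₁, le_rfl, (Int.toNat_of_nonneg (hnonneg m₁ le_rfl)).symm⟩
  obtain ⟨m₂, hm₂, hv⟩ := Nat.sInf_mem hSne
  set v := sInf S with hvdef
  have hmin : ∀ m, m₁ ≤ m → (v : ℤ) ≤ (f (m + 1) : ℤ) - f m := by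
    intro m hm
    have hmem : ((f (m + 1) : ℤ) - f m).toNat ∈ S := ⟨m, hm, (Int.toNat_of_nonneg (hnonneg m hm)).symm⟩
    have h1 := Nat.sInf_le hmem
    rw [← hvdef] at h1
    have h2 : ((v : ℕ) : ℤ) ≤ (((f (m + 1) : ℤ) - f m).toNat : ℤ) := by exact_mod_cast h1
    rwa [Int.toNat_of_nonneg (hnonneg m hm)] at h2
  have hconst : ∀ m, m₂ ≤ m → (f (m + 1) : ℤ) - f m = v := fun m hm =>
    le_antisymm (hv ▸ hmono m₂ m hm₂ hm) (hmin m (hm₂.trans hm))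
  refine ⟨v, (f m₂ : ℤ) - v * m₂, m₂, fun m hm => ?_⟩
  induction m, hm using Nat.le_induction with
  | base => ring
  | succ m hm ih =>
    have h1 := hconst m hm
    push_cast
    linarith

/-- **BOUNDED `p`-RANKS ⟹ `μ = 0` (growth form).** For a `ℤ_p`-extension `κ` of a number field with `rank_p Cl(K_m) ≤ B` for all `m`:
`ord_p h(K_m) = λ m + ν` for `m ≫ 0`. At finite level: with `B ≤ p^{k₀}` and Fukuda's index `n₀`, `Fukuda1994Thm1RankProofs.layer_data` (ii)
(unipotence mod `p` of the inertia generator on `A/pA`, `ν Y = pY`, `#(pY)² ≤ #Y`) gives `e_m + e_{m+2} ≤ 2e_{m+1}` for `m ≥ n₀ + k₀ + 1`, and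
concavity forces eventual linearity.  (Washington: `rank A_n` bounded ⟹ `μ = 0`, via `X/pX` finite and the structure theorem; none used here.)
[cite: Washington1997, §13.3 Prop. 13.23 (proof)] [cite: Fukuda1994, Thm. 1 (2), p. 264] -/
theorem classicalMuVanishes_of_forall_classGroupPRank_le (κ : ZpExtension K p) {B : ℕ} (hB : ∀ m, classGroupPRank κ m ≤ B) :
    ClassicalMuVanishes κ := by
  obtain ⟨n₀, hn₀⟩ := exists_totallyRamifiedFrom κ
  have hp1 : 1 < p := hp.out.one_lt
  -- `B ≤ p^B`
  have hBk : B ≤ p ^ B := (Nat.lt_pow_self hp1).le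
  have hconc : ∀ m, n₀ + B + 1 ≤ m → classNumberPExp κ m + classNumberPExp κ (m + 2) ≤ 2 * classNumberPExp κ (m + 1) := by
    intro m hm
    obtain ⟨k, rfl⟩ : ∃ k, m = n₀ + k := ⟨m - n₀, by omega⟩
    have h := (layer_data κ hn₀ le_rfl (k + 2) (by omega)).2 B B k rfl (by omega) (hB _) hBk
    simpa [add_assoc] using h
  obtain ⟨l, ν, n₁, hlin⟩ := eventually_linear_of_concave' hconc
  exact ⟨l, ν, n₁, hlin⟩

/-- **«`μ = 0` ⟺ the `p`-ranks are bounded» (Washington, Prop. 13.23) as a tree theorem**, for every `ℤ_p`-extension of every number field,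
proved at finite level in both directions (`exists_forall_classGroupPRank_le_of_classicalMuVanishes`, `classicalMuVanishes_of_forall_classGroupPRank_le`)
— no structure theory of `Λ`-modules, no growth theorem. [cite: Washington1997, §13.3 Prop. 13.23] [cite: Lang1990, Ch. 5 §1 Thm. 1.2 (iii)] -/
theorem classicalMuVanishes_iff_exists_forall_classGroupPRank_le (κ : ZpExtension K p) :
    ClassicalMuVanishes κ ↔ ∃ B : ℕ, ∀ m, classGroupPRank κ m ≤ B :=
  ⟨exists_forall_classGroupPRank_le_of_classicalMuVanishes κ, fun ⟨_, hB⟩ => classicalMuVanishes_of_forall_classGroupPRank_le κ hB⟩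

/-! ## §2 Linear upper bounds and the inequality form of the μ-descent — WITHOUT Iwasawa's growth theorem -/

/-- **A LINEAR UPPER BOUND `e_n ≤ a n + b` (`n ≥ n₁`) forces `μ = 0` in growth form** — the hI-free twin of
`ClassicalMuVanishesDescent.classicalMuVanishes_of_classNumberPExp_le_linear` (there: `p^n` outgrows `a n + b` under the growth theorem;
here: linear bound ⟹ bounded ranks ⟹ growth form, both at finite level). [cite: Washington1997, §13.3 Prop. 13.23] [cite: Lang1990, Ch. 5 §1 Thm. 1.2 (iii)] -/
theorem classicalMuVanishes_of_classNumberPExp_le_linear' (κ : ZpExtension K p) {a b n₁ : ℕ}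
    (hle : ∀ n, n₁ ≤ n → classNumberPExp κ n ≤ a * n + b) : ClassicalMuVanishes κ := by
  obtain ⟨B, hB⟩ := exists_forall_classGroupPRank_le_of_classNumberPExp_le_linear κ hle
  exact classicalMuVanishes_of_forall_classGroupPRank_le κ hB

/-- **μ-descent, inequality form, hI-free** (twin of `ClassicalMuVanishesDescent.classicalMuVanishes_of_le_sum`): if
`e_n(κ) ≤ ∑ᵢ cᵢ·e_n(κᵢ) + b` for `n ≥ n₀` (finitely many `ℤ_p`-extensions `κᵢ`, e.g. the fixed fields of a norm relation with `p ∤ d`,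
[BiasseEtAl2022] Prop. 3.7 layer by layer) and every `κᵢ` has `μ = 0` in growth form, then so does `κ`.
[cite: BiasseEtAl2022, Prop. 3.7] [cite: Lang1990, Ch. 5 §1 Thm. 1.2 (iii)] -/
theorem classicalMuVanishes_of_le_sum' (κ : ZpExtension K p)
    {ι : Type} [Fintype ι] {F : ι → Type} [∀ i, Field (F i)]
    (κs : ∀ i, ZpExtension (F i) p) (c : ι → ℕ) {b n₀ : ℕ}
    (hle : ∀ n, n₀ ≤ n → classNumberPExp κ n ≤ (∑ i, c i * classNumberPExp (κs i) n) + b)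
    (hμ : ∀ i, ClassicalMuVanishes (κs i)) : ClassicalMuVanishes κ := by
  obtain ⟨B, hB⟩ := exists_forall_classGroupPRank_le_of_le_sum κ κs c hle hμ
  exact classicalMuVanishes_of_forall_classGroupPRank_le κ hB

/-! ## §3 The two generic tower descents, hI-free -/

section Tower

variable {F : Type} [Field F] [NumberField F]

/-- **`μ(κ|_{K'}) = 0 ⟹ μ(κ|_K) = 0` for `K ⊆ K'` with `p ∤ [K' : K]`, hI-free** (twin of
`ClassicalMuVanishesSubextension.classicalMuVanishes_restrict_of_tower`; the per-layer inequality is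
`classNumberPExp_restrict_le_of_not_dvd_finrank`). [cite: NeukirchANT1999, Ch. III §1 Prop. (1.6) (ii)] [cite: Washington1997, §13.1] -/
theorem classicalMuVanishes_restrict_of_tower' (κ : ZpExtension F p)
    (M : Type) [Field M] [NumberField M] [Algebra F M] (M' : Type) [Field M'] [NumberField M'] [Algebra F M']
    [Algebra M M'] [IsScalarTower F M M'] (hpM : ¬ p ∣ Module.finrank M M')
    (hM : Function.Surjective (κ.toContinuousMonoidHom.comp (absGaloisRestrict F M)))
    (hM' : Function.Surjective (κ.toContinuousMonoidHom.comp (absGaloisRestrict F M')))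
    (hμ : ClassicalMuVanishes (κ.restrict M' hM')) : ClassicalMuVanishes (κ.restrict M hM) := by
  refine classicalMuVanishes_of_le_sum' (κ.restrict M hM) (ι := Unit) (fun _ => κ.restrict M' hM') (fun _ => 1)
    (b := 0) (n₀ := 0) (fun n _ => ?_) (fun _ => hμ)
  simpa using classNumberPExp_restrict_le_of_not_dvd_finrank κ M M' hpM hM hM' n

/-- **Consumer form, hI-free** (twin of `ClassicalMuVanishesSubextension.classicalMuVanishes_of_isCyclotomic_of_tower`): `μ = 0` for every
cyclotomic `ℤ_p`-extension of `M'` ⇒ the same for every subfield `M ⊇ F` of `M'` with `p ∤ [M' : F]`.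
[cite: Washington1997, §13.1] [cite: NeukirchANT1999, Ch. III §1 Prop. (1.6) (ii)] -/
theorem classicalMuVanishes_of_isCyclotomic_of_tower' (κ : ZpExtension F p) (hκ : κ.IsCyclotomic)
    (M : Type) [Field M] [NumberField M] [Algebra F M] (M' : Type) [Field M'] [NumberField M'] [Algebra F M']
    [Algebra M M'] [IsScalarTower F M M'] (hpM' : ¬ p ∣ Module.finrank F M')
    (hμ : ∀ κ' : ZpExtension M' p, κ'.IsCyclotomic → ClassicalMuVanishes κ')
    (κM : ZpExtension M p) (hκM : κM.IsCyclotomic) : ClassicalMuVanishes κM := by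
  haveI : FiniteDimensional F M := Module.Finite.of_restrictScalars_finite ℚ F M
  haveI : FiniteDimensional F M' := Module.Finite.of_restrictScalars_finite ℚ F M'
  haveI : FiniteDimensional M M' := Module.Finite.of_restrictScalars_finite F M M'
  have hMM' := Module.finrank_mul_finrank F M M'
  have hpM : ¬ p ∣ Module.finrank F M := fun h => hpM' (hMM' ▸ dvd_mul_of_dvd_left h _)
  have hpd : ¬ p ∣ Module.finrank M M' := fun h => hpM' (hMM' ▸ dvd_mul_of_dvd_right h _)
  have hM := surjective_comp_absGaloisRestrict_of_not_dvd_finrank κ M hpM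
  have hM' := surjective_comp_absGaloisRestrict_of_not_dvd_finrank κ M' hpM'
  have h1 : ClassicalMuVanishes (κ.restrict M hM) :=
    classicalMuVanishes_restrict_of_tower' κ M M' hpd hM hM' (hμ _ (isCyclotomic_restrict κ hκ M' hM'))
  exact (classicalMuVanishes_iff_of_isCyclotomic _ _ (isCyclotomic_restrict κ hκ M hM) hκM).mp h1

/-- **μ-descent along a norm relation, hI-free** (twin of `ClassicalMuVanishesNormRelationTower.classicalMuVanishes_restrict_of_normRelation`;
the per-layer inequality is `classNumberPExp_restrict_le_sum_of_normRelation`). [cite: BiasseEtAl2022, Prop. 3.7] [cite: Washington1997, §13.1] -/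
theorem classicalMuVanishes_restrict_of_normRelation' (κ : ZpExtension F p) (L : Type) [Field L] [NumberField L] [Algebra F L]
    [IsGalois F L] [Fintype (L ≃ₐ[F] L)] [DecidableEq (L ≃ₐ[F] L)]
    (hL : Function.Surjective (κ.toContinuousMonoidHom.comp (absGaloisRestrict F L)))
    {ι : Type} [Fintype ι] (H : ι → Subgroup (L ≃ₐ[F] L)) [∀ i, Fintype (H i)]
    (a b : ι → (L ≃ₐ[F] L) → ℤ) {d : ℕ} (hpd : ¬ p ∣ d)
    (hrel : ∀ g : L ≃ₐ[F] L,
      (∑ i, ∑ x : L ≃ₐ[F] L, ∑ h : H i, a i x * b i ((h : L ≃ₐ[F] L)⁻¹ * x⁻¹ * g)) =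
        if g = 1 then (d : ℤ) else 0)
    (hH : ∀ i, Function.Surjective
      (κ.toContinuousMonoidHom.comp (absGaloisRestrict F ↥(fixedField (H i)))))
    (hμ : ∀ i, ClassicalMuVanishes (κ.restrict ↥(fixedField (H i)) (hH i))) :
    ClassicalMuVanishes (κ.restrict L hL) := by
  refine classicalMuVanishes_of_le_sum' (κ.restrict L hL)
    (fun i => κ.restrict ↥(fixedField (H i)) (hH i)) (fun _ => 1) (b := 0) (n₀ := 0)
    (fun n _ => ?_) hμ
  simpa only [one_mul, add_zero] using
    classNumberPExp_restrict_le_sum_of_normRelation κ L hL H a b hpd hrel hH n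

omit [Fact p.Prime] in
/-- `p ∤ [L^{H} : F]` when `p ∤ [L : F]` (tower law). [folklore] -/
private theorem not_dvd_finrank_fixedField'' (L : Type) [Field L] [Algebra F L] [FiniteDimensional F L]
    (hp : ¬ p ∣ Module.finrank F L) (H : Subgroup (L ≃ₐ[F] L)) :
    ¬ p ∣ Module.finrank F ↥(fixedField H) := fun h =>
  hp (h.trans (Dvd.intro _ (Module.finrank_mul_finrank F ↥(fixedField H) L)))

/-- **Consumer form (cyclotomic towers), hI-free** (twin of `classicalMuVanishes_of_isCyclotomic_of_normRelation`): `L/F` finite Galois,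
`p ∤ [L : F]`, a norm relation `d = ∑ᵢ aᵢ N_{Hᵢ} bᵢ` of `Gal(L/F)` with `p ∤ d`; if `μ = 0` holds for every cyclotomic `ℤ_p`-extension of each
`L^{Hᵢ}`, then for every cyclotomic `ℤ_p`-extension of `L`. [cite: BiasseEtAl2022, Prop. 3.7] [cite: Washington1997, §13.1] -/
theorem classicalMuVanishes_of_isCyclotomic_of_normRelation'' (κ : ZpExtension F p) (hκ : κ.IsCyclotomic) (L : Type) [Field L]
    [NumberField L] [Algebra F L] [IsGalois F L] [Fintype (L ≃ₐ[F] L)] [DecidableEq (L ≃ₐ[F] L)] (hp : ¬ p ∣ Module.finrank F L)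
    {ι : Type} [Fintype ι] (H : ι → Subgroup (L ≃ₐ[F] L)) [∀ i, Fintype (H i)]
    (a b : ι → (L ≃ₐ[F] L) → ℤ) {d : ℕ} (hpd : ¬ p ∣ d)
    (hrel : ∀ g : L ≃ₐ[F] L,
      (∑ i, ∑ x : L ≃ₐ[F] L, ∑ h : H i, a i x * b i ((h : L ≃ₐ[F] L)⁻¹ * x⁻¹ * g)) =
        if g = 1 then (d : ℤ) else 0)
    (hμ : ∀ i, ∀ κE : ZpExtension ↥(fixedField (H i)) p, κE.IsCyclotomic → ClassicalMuVanishes κE)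
    (κL : ZpExtension L p) (hκL : κL.IsCyclotomic) : ClassicalMuVanishes κL := by
  haveI : FiniteDimensional F L := Module.Finite.of_restrictScalars_finite ℚ F L
  have hL := surjective_comp_absGaloisRestrict_of_not_dvd_finrank κ L hp
  have hH : ∀ i, Function.Surjective
      (κ.toContinuousMonoidHom.comp (absGaloisRestrict F ↥(fixedField (H i)))) := fun i =>
    surjective_comp_absGaloisRestrict_of_not_dvd_finrank κ _ (not_dvd_finrank_fixedField'' L hp (H i))
  have h1 : ClassicalMuVanishes (κ.restrict L hL) :=
    classicalMuVanishes_restrict_of_normRelation' κ L hL H a b hpd hrel hH fun i =>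
      hμ i _ (isCyclotomic_restrict κ hκ _ (hH i))
  exact (classicalMuVanishes_iff_of_isCyclotomic _ _ (isCyclotomic_restrict κ hκ L hL) hκL).mp h1

/-- **The same with no `κ` chosen** (twin of `classicalMuVanishes_of_isCyclotomic_of_normRelation'` of
`ClassicalMuVanishesNormRelationTowerCyclotomic`; the cyclotomic `ℤ_p`-extension of `F` exists, `exists_cyclotomicZpExtension_holds`).
[cite: BiasseEtAl2022, Prop. 3.7] [cite: Washington1997, §13.1] -/
theorem classicalMuVanishes_of_isCyclotomic_of_normRelation_noGrowth (L : Type) [Field L] [NumberField L] [Algebra F L] [IsGalois F L]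
    [Fintype (L ≃ₐ[F] L)] [DecidableEq (L ≃ₐ[F] L)] (hp : ¬ p ∣ Module.finrank F L)
    {ι : Type} [Fintype ι] (H : ι → Subgroup (L ≃ₐ[F] L)) [∀ i, Fintype (H i)]
    (a b : ι → (L ≃ₐ[F] L) → ℤ) {d : ℕ} (hpd : ¬ p ∣ d)
    (hrel : ∀ g : L ≃ₐ[F] L,
      (∑ i, ∑ x : L ≃ₐ[F] L, ∑ h : H i, a i x * b i ((h : L ≃ₐ[F] L)⁻¹ * x⁻¹ * g)) =
        if g = 1 then (d : ℤ) else 0)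
    (hμ : ∀ i, ∀ κE : ZpExtension ↥(fixedField (H i)) p, κE.IsCyclotomic → ClassicalMuVanishes κE)
    (κL : ZpExtension L p) (hκL : κL.IsCyclotomic) : ClassicalMuVanishes κL := by
  obtain ⟨κ, hκ⟩ := exists_cyclotomicZpExtension_holds F p
  exact classicalMuVanishes_of_isCyclotomic_of_normRelation'' κ hκ L hp H a b hpd hrel hμ κL hκL

end Tower

end Literature.NumberTheory.IwasawaTheory

end
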